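import Summits.BirchSwinnertonDyer.BirchSwinnertonDyer.Theorems.GenusKolyvaginAtTwoPowDvdShaCardAtTwoRTNonPhantomTwoTorsionValues
import HarnessLib

/-!
# Route `GenusKolyvaginAtTwo`, crux L_T `PowDvdShaCardAtTwoRT` (stmt-BirchSwinnertonDyer-23242), LINE 18 stub L, bottom rung:
# the NON-PHANTOM lemma (III) — `H¹(GL₂(ℤ/4), (ℤ/4)²) → H¹(⟨(1 1; 0 1)⟩, (ℤ/4)²)` is injective

Seat `bsd-line-gk2-p3` g22 (PROVER 3/3, cell `bsd-f1-sign2`), `--supports stmt-BirchSwinnertonDyer-23242` (helper).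
THEOREMS ONLY (Mathlib + files (I), (II); no definition, no named fact, no `sorry`). BSD is not proved by any of this;
neither is the crux. File 3 of 3.

THIS FILE:
* `NonPhantom.coboundary_of_apply_transvection_eq_zero` — step (1), the `−1` trick: with `φ u = 0` only, the central
  `z = −1` gives `φ g + φ g = φ z − g • φ z`, `φ z = a • P₁` with `a` even, and `φ + d(−a/2 • P₁)` has values in
  `M[2]` and still vanishes at `u`; conclude by file (II).
* `NonPhantom.coboundary_of_basis_data` — step (0): a cocycle merely PRINCIPAL on `u` (`φ u = u • m − m`) is
  normalised by `−dm`; the lower transvection is `ℓ = s u s⁻¹`.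
* `NonPhantom.coboundary_of_unipotent_of_surjective` — THE NATURAL FORM: `4M = 0`, `#M = 16`, `M[2] ≤ 2M`, every
  additive automorphism of `M` realised in `Γ` (the tree's `HasSurjectiveModNGaloisRep 4`), ONE `u ∈ Γ` with
  `(u − 1)² = 0` moving `M[2]` (tree: `WeierstrassCurve.exists_unipotent_geomTorsion_of_hasMultiplicativeReductionAt_of_not_dvd`
  at a multiplicative place with `ord_v Δ_min` odd), and a cocycle vanishing on the kernel of the action and principal
  on `u` ⟹ coboundary.  The basis `P₁ = uP₂ − P₂`, `2P₂ ∈ M[2]` moved by `u`, is adapted to `u`; the swap, `−1`,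
  `diag(−1,1)` come through the coordinate isomorphism `ZMod 4 × ZMod 4 ≃+ M`.

USE (next files of the seat): in the tree's currency `galH1Torsion`/`h1Eval`/`torsionFixing` this is the level-`4`
substitute for Gross's `eq_zero_of_h1Eval_eq_zero` (which needs `2` invertible): a class `x ∈ H¹(K, E[4])` with
`[x, ρ] = 0` on `Γ_{K(E[4])}` and unramified at ONE multiplicative prime `v ∤ 2` with `ord_v Δ` odd is `0`; whence the
separation hypothesis `hres` of the pair Čebotarev for spans of classes that are Kummer at such a prime.

References: T. Lawson, C. Wuthrich, *Vanishing of some Galois cohomology groups for elliptic curves*, in: Elliptic Curves,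
Modular Forms and Iwasawa Theory, Springer Proc. Math. Stat. 188 (2016), §7.1 and §8 [arXiv:1505.02940];
B. H. Gross, *Kolyvagin's work on modular elliptic curves* (1991), Prop. 9.1 (the odd-`p` injectivity whose `p = 2`
substitute this is); J.-P. Serre, *Abelian ℓ-adic representations* (1968), IV A.1.2 (Tate transvection).
-/

-- `Summit.<P>.<Sub>` repeats `BirchSwinnertonDyer` by the tree's layout convention (D-0017)
set_option linter.dupNamespace false
set_option autoImplicit false

namespace Summit.BirchSwinnertonDyer.BirchSwinnertonDyer.Theorems.GenusExact.NonPhantom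

variable {Γ : Type*} [Group Γ] {M : Type*} [AddCommGroup M] [DistribMulAction Γ M]

section Core

variable {P₁ P₂ : M}

/-- **Core, general values: the `−1` trick.**  Same data, but now only `φ u = 0`: the central element `z = −1` gives
`φ g + φ g = φ z − g • φ z`; `φ z` is `u`-fixed hence a multiple `a • P₁`, and `ℓ` forces `a` even, so `φ` is
cohomologous (by `d(a/2 • P₁)`, which still vanishes at `u`) to a cocycle with values in `M[2]`, handled by
`coboundary_of_two_torsion_values`. [cite: LawsonWuthrich2016, §7.1 and §8] -/
theorem coboundary_of_apply_transvection_eq_zero (hM4 : ∀ m : M, (4 : ℤ) • m = 0)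
    (hspan : ∀ m : M, ∃ a b : ℤ, m = a • P₁ + b • P₂)
    (hindep : ∀ a b : ℤ, a • P₁ + b • P₂ = 0 → (4 : ℤ) ∣ a ∧ (4 : ℤ) ∣ b)
    {u ℓ s z e₁ : Γ} (huP₁ : u • P₁ = P₁) (huP₂ : u • P₂ = P₁ + P₂)
    (hℓP₁ : ℓ • P₁ = P₁ + P₂) (hℓP₂ : ℓ • P₂ = P₂)
    (hsP₁ : s • P₁ = P₂) (hsP₂ : s • P₂ = P₁) (hz : ∀ m : M, z • m = -m)
    (heP₁ : e₁ • P₁ = -P₁) (heP₂ : e₁ • P₂ = P₂)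
    {φ : Γ → M} (hφ : ∀ g h, φ (g * h) = φ g + g • φ h)
    (hker : ∀ ρ : Γ, (∀ m : M, ρ • m = m) → φ ρ = 0) (hφu : φ u = 0) :
    ∃ v : M, ∀ g, φ g = g • v - v := by
  have h4P₁ := hM4 P₁
  have h4P₂ := hM4 P₂
  -- the central element: `φ g + φ g = φ z - g • φ z`
  have hE : ∀ g : Γ, φ g + φ g = φ z - g • φ z := by
    intro g
    have hcomm : ∀ m : M, (g * z) • m = (z * g) • m := fun m ↦ by
      rw [mul_smul, mul_smul, hz, hz, smul_neg]
    have h := cocycle_eq_of_forall_smul_eq hφ hker hcomm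
    rw [hφ, hφ, hz] at h
    rw [eq_sub_iff_add_eq, add_assoc, h]
    abel
  -- `φ z = a • P₁` with `a` even
  obtain ⟨a, b, hab⟩ := hspan (φ z)
  have hb : (4 : ℤ) ∣ b := by
    have h := hE u
    rw [hφu, add_zero, hab, smul_lincomb, huP₁, huP₂] at h
    have h0 : (-b) • P₁ + (0 : ℤ) • P₂ = 0 := by
      rw [show (-b) • P₁ + (0 : ℤ) • P₂ = a • P₁ + b • P₂ - (a • P₁ + b • (P₁ + P₂)) by module]
      exact h.symm
    have := (hindep _ _ h0).1
    omega
  have hc : φ z = a • P₁ := by rw [hab, zsmul_eq_zero_of_four_dvd h4P₂ hb, add_zero]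
  obtain ⟨α, β, hαβ⟩ := hspan (φ ℓ)
  have ha : (2 : ℤ) ∣ a := by
    have h := hE ℓ
    rw [hαβ, hc, smul_zsmul_comm, hℓP₁] at h
    have h0 : (2 * α) • P₁ + (2 * β + a) • P₂ = 0 := by
      rw [show (2 * α) • P₁ + (2 * β + a) • P₂ = α • P₁ + β • P₂ + (α • P₁ + β • P₂) - (a • P₁ - a • (P₁ + P₂))
        by module, h, sub_self]
    have := (hindep _ _ h0).2
    omega
  obtain ⟨a', rfl⟩ := ha
  -- shift by the coboundary of `c₁ = -a' • P₁`
  obtain ⟨c₁, hc₁⟩ : ∃ c₁ : M, c₁ = (-a') • P₁ := ⟨_, rfl⟩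
  obtain ⟨φ₁, hφ₁def⟩ : ∃ φ₁ : Γ → M, φ₁ = fun g ↦ φ g - (g • c₁ - c₁) := ⟨_, rfl⟩
  have hφ₁app : ∀ g, φ₁ g = φ g - (g • c₁ - c₁) := fun g ↦ by rw [hφ₁def]
  have hφ₁ : ∀ g h, φ₁ (g * h) = φ₁ g + g • φ₁ h := by rw [hφ₁def]; exact cocycle_sub_coboundary hφ c₁
  have hker₁ : ∀ ρ : Γ, (∀ m : M, ρ • m = m) → φ₁ ρ = 0 := by rw [hφ₁def]; exact ker_sub_coboundary hker c₁
  have hφ₁u : φ₁ u = 0 := by rw [hφ₁app, hφu, hc₁, smul_zsmul_comm, huP₁, sub_self, sub_zero]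
  have h2φ₁ : ∀ g, (2 : ℤ) • φ₁ g = 0 := by
    intro g
    rw [hφ₁app, two_zsmul, show φ g - (g • c₁ - c₁) + (φ g - (g • c₁ - c₁)) =
      (φ g + φ g) - (g • (c₁ + c₁) - (c₁ + c₁)) by rw [smul_add]; abel, hE g, hc,
      show c₁ + c₁ = -((2 * a') • P₁) by rw [hc₁]; module, smul_neg, smul_zsmul_comm]
    abel
  obtain ⟨v, hv⟩ := coboundary_of_two_torsion_values hM4 hspan hindep huP₁ huP₂ hℓP₁ hℓP₂ hsP₁ hsP₂ hz heP₁ heP₂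
    hφ₁ hker₁ hφ₁u h2φ₁
  refine ⟨v + c₁, fun g ↦ ?_⟩
  have := hv g
  rw [hφ₁app, sub_eq_iff_eq_add] at this
  rw [this, smul_add]
  abel

/-- **THE NON-PHANTOM LEMMA, basis form.**  `M ∋ P₁, P₂` with `4M = 0`, `M = ℤP₁ + ℤP₂` freely mod `4`; `u, s, z, e₁ ∈ Γ`
acting as `(1 1; 0 1)`, `(0 1; 1 0)`, `−1`, `diag(−1, 1)`; `φ` a `1`-cocycle vanishing on the kernel of the action
(a PHANTOM class: restriction to `Γ_{K(E[4])}` is zero) and PRINCIPAL ON `u` (`φ u = u • m − m`: e.g. unramified at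
a multiplicative prime whose inertia contains `u`).  Then `φ` is a coboundary — i.e. the class is `0`.  This is the
injectivity of `H¹(GL₂(ℤ/4), (ℤ/4)²) → H¹(⟨u⟩, (ℤ/4)²)`. [cite: LawsonWuthrich2016, §7.1 and §8]
[cite: SerreAbelianLadic1968, Ch. IV, A.1.2] -/
theorem coboundary_of_basis_data (hM4 : ∀ m : M, (4 : ℤ) • m = 0)
    (hspan : ∀ m : M, ∃ a b : ℤ, m = a • P₁ + b • P₂)
    (hindep : ∀ a b : ℤ, a • P₁ + b • P₂ = 0 → (4 : ℤ) ∣ a ∧ (4 : ℤ) ∣ b)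
    {u s z e₁ : Γ} (huP₁ : u • P₁ = P₁) (huP₂ : u • P₂ = P₁ + P₂)
    (hsP₁ : s • P₁ = P₂) (hsP₂ : s • P₂ = P₁) (hz : ∀ m : M, z • m = -m)
    (heP₁ : e₁ • P₁ = -P₁) (heP₂ : e₁ • P₂ = P₂)
    {φ : Γ → M} (hφ : ∀ g h, φ (g * h) = φ g + g • φ h)
    (hker : ∀ ρ : Γ, (∀ m : M, ρ • m = m) → φ ρ = 0) (hφu : ∃ m : M, φ u = u • m - m) :
    ∃ v : M, ∀ g, φ g = g • v - v := by
  -- the lower transvection `ℓ = s u s⁻¹`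
  have hsiP₁ : s⁻¹ • P₁ = P₂ := by rw [inv_smul_eq_iff, hsP₂]
  have hsiP₂ : s⁻¹ • P₂ = P₁ := by rw [inv_smul_eq_iff, hsP₁]
  have hℓP₁ : (s * u * s⁻¹) • P₁ = P₁ + P₂ := by
    rw [mul_smul, mul_smul, hsiP₁, huP₂, smul_add, hsP₁, hsP₂, add_comm]
  have hℓP₂ : (s * u * s⁻¹) • P₂ = P₂ := by rw [mul_smul, mul_smul, hsiP₂, huP₁, hsP₁]
  -- Step 0: normalise `φ u = 0`
  obtain ⟨m₀, hm₀⟩ := hφu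
  obtain ⟨φ₀, hφ₀def⟩ : ∃ φ₀ : Γ → M, φ₀ = fun g ↦ φ g - (g • m₀ - m₀) := ⟨_, rfl⟩
  have hφ₀app : ∀ g, φ₀ g = φ g - (g • m₀ - m₀) := fun g ↦ by rw [hφ₀def]
  have hφ₀ : ∀ g h, φ₀ (g * h) = φ₀ g + g • φ₀ h := by rw [hφ₀def]; exact cocycle_sub_coboundary hφ m₀
  have hker₀ : ∀ ρ : Γ, (∀ m : M, ρ • m = m) → φ₀ ρ = 0 := by rw [hφ₀def]; exact ker_sub_coboundary hker m₀
  have hφ₀u : φ₀ u = 0 := by rw [hφ₀app, hm₀, sub_self]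
  obtain ⟨v, hv⟩ := coboundary_of_apply_transvection_eq_zero hM4 hspan hindep huP₁ huP₂ hℓP₁ hℓP₂ hsP₁ hsP₂ hz
    heP₁ heP₂ hφ₀ hker₀ hφ₀u
  refine ⟨v + m₀, fun g ↦ ?_⟩
  have := hv g
  rw [hφ₀app, sub_eq_iff_eq_add] at this
  rw [this, smul_add]
  abel

end Core

/-! ## §4 From the natural data: `Γ ↠ Aut M`, `M ≅ (ℤ/4)²`, one unipotent `u` moving `M[2]` -/

section Surjective

/-- An element `P` with `4P = 0`, `2P ≠ 0` has order exactly `4`: `b • P = 0 → 4 ∣ b`. [folklore] -/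
theorem four_dvd_of_zsmul_eq_zero {P : M} (h4 : (4 : ℤ) • P = 0) (h2 : (2 : ℤ) • P ≠ 0) {b : ℤ}
    (hb : b • P = 0) : (4 : ℤ) ∣ b := by
  have hmod : (b % 4) • P = 0 := by
    have e : b % 4 = b - 4 * (b / 4) := by omega
    rw [e, sub_smul, mul_comm, mul_smul, h4, smul_zero, sub_zero, hb]
  have hcases : b % 4 = 0 ∨ b % 4 = 1 ∨ b % 4 = 2 ∨ b % 4 = 3 := by omega
  rcases hcases with h | h | h | h
  · omega
  · rw [h, one_smul] at hmod
    exact absurd (by rw [hmod, smul_zero]) h2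
  · rw [h] at hmod
    exact absurd hmod h2
  · exfalso
    rw [h] at hmod
    apply h2
    rw [show (2 : ℤ) • P = (6 : ℤ) • P - (4 : ℤ) • P by module, h4, sub_zero,
      show (6 : ℤ) • P = (2 : ℤ) • ((3 : ℤ) • P) by module, hmod, smul_zero]

/-- **THE NON-PHANTOM LEMMA, natural form.**  Let `Γ` act on `M` with `4M = 0`, `#M = 16`, `M[2] ≤ 2M` (so
`M ≅ (ℤ/4)²`) and EVERY additive automorphism of `M` realised by some element of `Γ` (the tree's
`HasSurjectiveModNGaloisRep 4`).  Let `u ∈ Γ` be unipotent — `u (u m − m) = u m − m` — and move some element of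
`M[2]` (the Tate transvection supplied by the inertia group of a multiplicative prime with `ord_v Δ` odd, tree
`WeierstrassCurve.exists_unipotent_geomTorsion_of_hasMultiplicativeReductionAt_of_not_dvd`).  Then every `1`-cocycle
`φ : Γ → M` vanishing on the kernel of the action (a PHANTOM class of `H¹(K, E[4])`, i.e. one restricting to `0` on
`Γ_{K(E[4])}`) and principal on `u` is a coboundary.  Proof: the basis `P₁ = uP₂ − P₂`, `2P₂ =` the moved
`2`-torsion element, is adapted to `u = (1 1; 0 1)`; the swap, `−1` and `diag(−1,1)` come from surjectivity through the
coordinate isomorphism `ZMod 4 × ZMod 4 ≃+ M`; conclude by `coboundary_of_basis_data`.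
[cite: LawsonWuthrich2016, §7.1 and §8] [cite: SerreAbelianLadic1968, Ch. IV, A.1.2] -/
theorem coboundary_of_unipotent_of_surjective (hM4 : ∀ m : M, (4 : ℤ) • m = 0) (hcard : Nat.card M = 16)
    (h2M : ∀ m : M, (2 : ℤ) • m = 0 → ∃ y : M, m = (2 : ℤ) • y)
    (hsurj : ∀ f : M ≃+ M, ∃ g : Γ, ∀ m : M, g • m = f m)
    {u : Γ} (hu₁ : ∀ m : M, u • (u • m - m) = u • m - m) (hu₂ : ∃ Q : M, (2 : ℤ) • Q = 0 ∧ u • Q ≠ Q)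
    {φ : Γ → M} (hφ : ∀ g h, φ (g * h) = φ g + g • φ h)
    (hker : ∀ ρ : Γ, (∀ m : M, ρ • m = m) → φ ρ = 0) (hφu : ∃ m : M, φ u = u • m - m) :
    ∃ v : M, ∀ g, φ g = g • v - v := by
  classical
  -- the basis adapted to `u`
  obtain ⟨Q, h2Q, huQ⟩ := hu₂
  obtain ⟨P₂, hP₂⟩ := h2M Q h2Q
  obtain ⟨P₁, hP₁⟩ : ∃ P₁ : M, P₁ = u • P₂ - P₂ := ⟨_, rfl⟩
  have huP₁ : u • P₁ = P₁ := by rw [hP₁]; exact hu₁ P₂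
  have huP₂ : u • P₂ = P₁ + P₂ := by rw [hP₁, sub_add_cancel]
  have hQ0 : Q ≠ 0 := by rintro rfl; exact huQ (smul_zero u)
  have h2P₂ : (2 : ℤ) • P₂ ≠ 0 := by rw [← hP₂]; exact hQ0
  have h2P₁ : (2 : ℤ) • P₁ ≠ 0 := by
    rw [hP₁, smul_sub, ← smul_zsmul_comm, ← hP₂, sub_ne_zero]; exact huQ
  have hindep : ∀ a b : ℤ, a • P₁ + b • P₂ = 0 → (4 : ℤ) ∣ a ∧ (4 : ℤ) ∣ b := by
    intro a b hab
    have hu : a • P₁ + b • (P₁ + P₂) = 0 := by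
      calc a • P₁ + b • (P₁ + P₂) = u • (a • P₁ + b • P₂) := by rw [smul_lincomb, huP₁, huP₂]
        _ = 0 := by rw [hab, smul_zero]
    have hbP : b • P₁ = 0 := by
      rw [show b • P₁ = a • P₁ + b • (P₁ + P₂) - (a • P₁ + b • P₂) by module, hu, hab, sub_zero]
    have hb := four_dvd_of_zsmul_eq_zero (hM4 P₁) h2P₁ hbP
    have haP : a • P₁ = 0 := by rwa [zsmul_eq_zero_of_four_dvd (hM4 P₂) hb, add_zero] at hab
    exact ⟨four_dvd_of_zsmul_eq_zero (hM4 P₁) h2P₁ haP, hb⟩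
  -- the coordinate map `ZMod 4 × ZMod 4 →+ M`
  have h4P₁ : (zmultiplesHom M P₁) ((4 : ℕ) : ℤ) = 0 := by rw [zmultiplesHom_apply]; exact hM4 P₁
  have h4P₂ : (zmultiplesHom M P₂) ((4 : ℕ) : ℤ) = 0 := by rw [zmultiplesHom_apply]; exact hM4 P₂
  obtain ⟨f, hf⟩ : ∃ f : ZMod 4 × ZMod 4 →+ M,
      f = (ZMod.lift 4 ⟨zmultiplesHom M P₁, h4P₁⟩).coprod (ZMod.lift 4 ⟨zmultiplesHom M P₂, h4P₂⟩) := ⟨_, rfl⟩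
  have hfapp : ∀ a b : ℤ, f ((a : ZMod 4), (b : ZMod 4)) = a • P₁ + b • P₂ := by
    intro a b
    rw [hf, AddMonoidHom.coprod_apply, ZMod.lift_coe, ZMod.lift_coe]
    rfl
  have hfinj : Function.Injective f := by
    rw [injective_iff_map_eq_zero]
    rintro ⟨x, y⟩ hxy
    rw [← ZMod.intCast_zmod_cast x, ← ZMod.intCast_zmod_cast y, hfapp] at hxy
    obtain ⟨hx, hy⟩ := hindep _ _ hxy
    rw [Prod.mk_eq_zero, ← ZMod.intCast_zmod_cast x, ← ZMod.intCast_zmod_cast y,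
      ZMod.intCast_zmod_eq_zero_iff_dvd, ZMod.intCast_zmod_eq_zero_iff_dvd]
    exact ⟨by exact_mod_cast hx, by exact_mod_cast hy⟩
  haveI : Finite M := Nat.finite_of_card_ne_zero (by rw [hcard]; norm_num)
  have hfbij : Function.Bijective f :=
    hfinj.bijective_of_nat_card_le (by rw [hcard, Nat.card_prod, Nat.card_zmod])
  have hspan : ∀ m : M, ∃ a b : ℤ, m = a • P₁ + b • P₂ := by
    intro m
    obtain ⟨⟨x, y⟩, rfl⟩ := hfbij.2 m
    exact ⟨x.cast, y.cast, by rw [← hfapp, ZMod.intCast_zmod_cast, ZMod.intCast_zmod_cast]⟩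
  obtain ⟨e, he⟩ : ∃ e : ZMod 4 × ZMod 4 ≃+ M, ∀ p, e p = f p := ⟨AddEquiv.ofBijective f hfbij, fun _ ↦ rfl⟩
  have he10 : e (1, 0) = P₁ := by
    rw [he, show ((1 : ZMod 4), (0 : ZMod 4)) = (((1 : ℤ) : ZMod 4), ((0 : ℤ) : ZMod 4)) by simp, hfapp,
      one_smul, zero_smul, add_zero]
  have he01 : e (0, 1) = P₂ := by
    rw [he, show ((0 : ZMod 4), (1 : ZMod 4)) = (((0 : ℤ) : ZMod 4), ((1 : ℤ) : ZMod 4)) by simp, hfapp,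
      one_smul, zero_smul, zero_add]
  have heP₁ : e.symm P₁ = (1, 0) := by rw [AddEquiv.symm_apply_eq, he10]
  have heP₂ : e.symm P₂ = (0, 1) := by rw [AddEquiv.symm_apply_eq, he01]
  -- the auxiliary elements: `z = −1`, the swap `s`, and `e₁ = diag(−1, 1)`
  obtain ⟨z, hz⟩ := hsurj (AddEquiv.neg M)
  simp only [AddEquiv.neg_apply] at hz
  obtain ⟨s, hs⟩ := hsurj (e.symm.trans ((AddEquiv.prodComm).trans e))
  have hsP₁ : s • P₁ = P₂ := by
    rw [hs, AddEquiv.trans_apply, AddEquiv.trans_apply, heP₁, AddEquiv.coe_prodComm, Prod.swap_prod_mk, he01]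
  have hsP₂ : s • P₂ = P₁ := by
    rw [hs, AddEquiv.trans_apply, AddEquiv.trans_apply, heP₂, AddEquiv.coe_prodComm, Prod.swap_prod_mk, he10]
  obtain ⟨e₁, he₁⟩ := hsurj (e.symm.trans ((AddEquiv.prodCongr (AddEquiv.neg (ZMod 4)) (AddEquiv.refl _)).trans e))
  have hpc₁ : (AddEquiv.prodCongr (AddEquiv.neg (ZMod 4)) (AddEquiv.refl (ZMod 4))) (1, 0) = -(1, 0) := by
    rw [Prod.neg_mk, neg_zero]; rfl
  have hpc₂ : (AddEquiv.prodCongr (AddEquiv.neg (ZMod 4)) (AddEquiv.refl (ZMod 4))) (0, 1) = (0, 1) := by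
    rw [show ((0 : ZMod 4), (1 : ZMod 4)) = (-0, 1) by rw [neg_zero]]; rfl
  have he₁P₁ : e₁ • P₁ = -P₁ := by
    rw [he₁, AddEquiv.trans_apply, AddEquiv.trans_apply, heP₁, hpc₁, map_neg, he10]
  have he₁P₂ : e₁ • P₂ = P₂ := by
    rw [he₁, AddEquiv.trans_apply, AddEquiv.trans_apply, heP₂, hpc₂, he01]
  exact coboundary_of_basis_data hM4 hspan hindep huP₁ huP₂ hsP₁ hsP₂ hz he₁P₁ he₁P₂ hφ hker hφu

end Surjective

end Summit.BirchSwinnertonDyer.BirchSwinnertonDyer.Theorems.GenusExact.NonPhantom
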